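import Literature.NumberTheory.EllipticCurves.BhargavaShankarEq31FrontierProofs
import HarnessLib

/-!
# Bhargava–Shankar, display (31): the sieve step (†) is equivalent to eq. (31) granted Thm 2.1

`Proofs` companion (theorems only: no definitions, no named facts) of
`BhargavaShankarLocalMasses.lean` and `BhargavaShankarCounting.lean`. Source: M. Bhargava,
A. Shankar, *Binary quartic forms having bounded invariants, and the boundedness of the average
rank of elliptic curves*, Ann. of Math. (2) 181 (2015) 191–242; numbering of the held arXiv text
`arXiv:1006.1002v2` (§5.4, proof of Thm 5.14, display (31); = published version §3.6, proof of
Thm 3.19, first display).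

## What is proved

The tree holds two named facts cut from the same printed display (31) for the family `F` of all
elliptic curves:

* (†) `bhargavaShankar_locSolIrredClassCount_asymptotic` — lines 1–2 of (31), the sieve step
  `N(S^F; 2¹²X) = N(V_ℤ^{(0)} ∪ V_ℤ^{(2+)} ∪ V_ℤ^{(1)}; 2¹²X) · ∏_p |2¹⁰/27|_p M_p(V,F) + o(X^{5/6})`
  (real `X → ∞`);
* eq. (31) assembled, `bhargavaShankar_sum_irredClassCount_asymptotic` — lines 1–4 with Prop. 5.12
  and Lemma 5.16 folded in, in the tree's normalisation (`X : ℕ`, constant `2·c_F`).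

`BhargavaShankarEq31Proofs` / `BhargavaShankarEq31FrontierProofs` prove (†) ∧ Thm 2.1 ⇒ eq. (31)
(`bhargavaShankar_sum_irredClassCount_asymptotic_of_two_facts`; Lemma 5.16 is the theorem
`brumerKramer_card_quotient_two_holds`). This file proves the converse, so that

  `bhargavaShankar_locSolIrredClassCount_asymptotic_iff (h16 : bhargavaShankar_classCount) :
     (†) ↔ eq. (31)`.

Consequences. (1) (†) is *exactly* eq. (31) with Thm 2.1 (`bhargavaShankar_classCount`) factored
out: it carries no statement risk of its own — given Thm 2.1 it holds iff eq. (31) does (and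
eq. (31), the input of the tree's derivation of Thm 1.1, `average_card_selmerTwo_of_two_BS_facts`,
is conversely what Thm 1.1 for the family of all curves gives back through Thm 5.6,
Props 5.7–5.9 and Lemma 5.15 — informally; that direction is not formalised). (2) A discharge of
either fact discharges the other once Thm 2.1 is a theorem. (3) The remaining content of (†) is
the paper's sieve (published version: Thm 2.21 with Thms 2.12–2.13 and Props 3.6, 3.9, 3.18; see
`BhargavaShankarEq31FrontierProofs`, §3 of its module docstring), to be proved bottom-up from
Mathlib; it is not decomposed into further named facts.

## The argument (elementary; "limits along `ℕ` and along `ℝ` agree for monotone counts")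

Write `c₁ = 2¹⁰·27`, `L(Y) = N(S^F; Y)` (`locSolIrredClassCount`), `N'(Y) = N(V_ℤ^{(0)} ∪ V_ℤ^{(2+)} ∪
V_ℤ^{(1)}; Y)`, `P = ∏_p |2¹⁰/27|_p M_p(V,F)`, `κ = (8/27)ζ(2)`.
* `L` is monotone in `Y` (`locSolIrredClassCount_mono`): the `PGL₂(ℚ)`-classes met below height
  `Y` inject into those met below `Y' ≥ Y`, and these sets of classes are finite
  (`locSolIrred_traces_finite`, from the finiteness of the `GL₂(ℤ)`-orbit sets, Thm 2.1).
* eq. (31) and `Σ_{H(E_{A,B})<n} #{classes} = L(c₁ n)` (`sum_pgl2QClassCount_eq_locSolIrredClassCount`)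
  give `L(c₁ n)/n^{5/6} → 2c_F` along `n ∈ ℕ`; monotonicity and `⌊u⌋^{5/6} ~ u^{5/6} ~ (⌊u⌋+1)^{5/6}`
  upgrade this to real `u → ∞` (`tendsto_locSolIrredClassCount_div_rpow`).
* Thm 2.1 gives `N'(c₁u)/u^{5/6} → κ c₁^{5/6}` (`tendsto_classCount_union_div_rpow`), and
  `κ c₁^{5/6} P = 2c_F` (`eq31_sieve_constant`, the constant bookkeeping of `BhargavaShankarEq31Proofs`:
  `eq31_constant`, `hasProd_localFactor`). Hence `(L − N'P)(c₁u)/u^{5/6} → 0`; substituting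
  `u = 4X/27` (`c₁u = 2¹²X`) gives (†).

## References

* M. Bhargava, A. Shankar, Ann. of Math. (2) 181 (2015) 191–242 = arXiv:1006.1002, §5.4,
  display (31) and Thm 2.1 (arXiv v2 numbering). [cite: BhargavaShankarAnnals2015, §5.4 eq. (31) (arXiv:1006.1002v2 numbering)]
-/

noncomputable section

open scoped Classical
open Filter Topology Finset

namespace Literature.NumberTheory.EllipticCurves

open BinaryQuartic

/-! ## The set counted by `N(S^F; Y)`: finiteness of its orbit and class sets, monotonicity -/

/-- The `GL₂(ℤ)`-orbits of the locally soluble irreducible forms with invariants in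
`2⁴F^{inv} × 2⁶F^{inv}` and height `< Y` are finitely many, granted Thm 2.1: such forms have
nonzero discriminant, so their orbits are among those counted by `N(V_ℤ^{(i)}; Y)`, `i = 0, 1, 2`
(`finite_orbits_of_classCount`). [cite: BhargavaShankarAnnals2015, Thm 2.1 and §5.4 (arXiv:1006.1002v2 numbering)] -/
theorem locSolIrred_orbits_finite (h16 : bhargavaShankar_classCount) (Y : ℝ) :
    (gl2zOrbit '' {f : BinaryQuartic ℤ | f.IsLocallySoluble ∧ f.IsIrreducible ∧
        (∃ IJ ∈ invariantPairs, f.I = 2 ^ 4 * IJ.1 ∧ f.J = 2 ^ 6 * IJ.2) ∧ f.height < Y}).Finite := by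
  obtain ⟨h0, h1, h2, -⟩ := finite_orbits_of_classCount h16 Y
  refine ((h0.union h1).union h2).subset ?_
  rintro _ ⟨f, ⟨-, hirr, ⟨IJ, hIJ, hI, hJ⟩, hH⟩, rfl⟩
  obtain ⟨AB, hAB, rfl⟩ := (mem_invariantPairs_iff IJ).mp hIJ
  rcases mem_realTypes_of_disc_ne_zero (disc_ne_zero_of_invariants hAB hI hJ) with h | h | h
  · exact Or.inl (Or.inl ⟨f, ⟨h, hirr, hH⟩, rfl⟩)
  · exact Or.inl (Or.inr ⟨f, ⟨h, hirr, hH⟩, rfl⟩)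
  · exact Or.inr ⟨f, ⟨h, hirr, hH⟩, rfl⟩

/-- The set of `PGL₂(ℚ)`-classes (traces) counted by `N(S^F; Y) = locSolIrredClassCount Y` is
finite for every real `Y`, granted Thm 2.1. [cite: BhargavaShankarAnnals2015, Thm 2.1 and §5.4 (arXiv:1006.1002v2 numbering)] -/
theorem locSolIrred_traces_finite (h16 : bhargavaShankar_classCount) (Y : ℝ) :
    ((fun f ↦ {g | g ∈ {f : BinaryQuartic ℤ | f.IsLocallySoluble ∧ f.IsIrreducible ∧
        (∃ IJ ∈ invariantPairs, f.I = 2 ^ 4 * IJ.1 ∧ f.J = 2 ^ 6 * IJ.2) ∧ f.height < Y} ∧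
        PGL2Equiv (f.map (Int.castRingHom ℚ)) (g.map (Int.castRingHom ℚ))}) ''
      {f : BinaryQuartic ℤ | f.IsLocallySoluble ∧ f.IsIrreducible ∧
        (∃ IJ ∈ invariantPairs, f.I = 2 ^ 4 * IJ.1 ∧ f.J = 2 ^ 6 * IJ.2) ∧ f.height < Y}).Finite :=
  pgl2Traces_finite_of_orbits_finite _ (locSolIrred_orbits_finite h16 Y)

/-- **`N(S^F; Y)` is monotone in `Y`** (granted Thm 2.1, for finiteness): the classes met below
height `Y` inject into those met below `Y' ≥ Y` by saturation (`PGL₂(ℚ)`-equivalence preserves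
the invariants, hence the height, so no class is lost; finiteness makes `Set.ncard` honest).
[cite: BhargavaShankarAnnals2015, §5.4 p. 34 (N(S^F; ·); arXiv:1006.1002v2 numbering)] -/
theorem locSolIrredClassCount_mono (h16 : bhargavaShankar_classCount) {Y Y' : ℝ} (hYY' : Y ≤ Y') :
    locSolIrredClassCount Y ≤ locSolIrredClassCount Y' := by
  unfold locSolIrredClassCount pgl2QClassCount
  set ι := Int.castRingHom ℚ with hι
  set S : ℝ → Set (BinaryQuartic ℤ) := fun Z ↦ {f : BinaryQuartic ℤ | f.IsLocallySoluble ∧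
    f.IsIrreducible ∧ (∃ IJ ∈ invariantPairs, f.I = 2 ^ 4 * IJ.1 ∧ f.J = 2 ^ 6 * IJ.2) ∧
    f.height < Z} with hS
  have hsub : S Y ⊆ S Y' := fun f hf ↦ ⟨hf.1, hf.2.1, hf.2.2.1, hf.2.2.2.trans_le hYY'⟩
  -- the saturation in `S Y'` of a set of forms
  set Φ : Set (BinaryQuartic ℤ) → Set (BinaryQuartic ℤ) := fun c ↦
    {g | g ∈ S Y' ∧ ∃ f' ∈ c, PGL2Equiv (f'.map ι) (g.map ι)} with hΦ
  have hΦT : ∀ f ∈ S Y, Φ {g | g ∈ S Y ∧ PGL2Equiv (f.map ι) (g.map ι)} =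
      {g | g ∈ S Y' ∧ PGL2Equiv (f.map ι) (g.map ι)} := by
    intro f hf
    ext g
    simp only [hΦ, Set.mem_setOf_eq]
    constructor
    · rintro ⟨hg, f', ⟨-, hff'⟩, hf'g⟩
      exact ⟨hg, hff'.trans hf'g⟩
    · rintro ⟨hg, hfg⟩
      exact ⟨hg, f, ⟨hf, PGL2Equiv.refl _⟩, hfg⟩
  change ((fun f ↦ {g | g ∈ S Y ∧ PGL2Equiv (f.map ι) (g.map ι)}) '' S Y).ncard ≤
    ((fun f ↦ {g | g ∈ S Y' ∧ PGL2Equiv (f.map ι) (g.map ι)}) '' S Y').ncard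
  refine Set.ncard_le_ncard_of_injOn Φ ?_ ?_ (locSolIrred_traces_finite h16 Y')
  · rintro _ ⟨f, hf, rfl⟩
    exact ⟨f, hsub hf, (hΦT f hf).symm⟩
  · rintro _ ⟨f₁, hf₁, rfl⟩ _ ⟨f₂, hf₂, rfl⟩ heq
    simp only at heq
    rw [hΦT f₁ hf₁, hΦT f₂ hf₂] at heq
    have h12 : PGL2Equiv (f₁.map ι) (f₂.map ι) := by
      have : f₂ ∈ {g | g ∈ S Y' ∧ PGL2Equiv (f₁.map ι) (g.map ι)} := by
        rw [heq]; exact ⟨hsub hf₂, PGL2Equiv.refl _⟩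
      exact this.2
    ext g
    simp only [Set.mem_setOf_eq]
    exact ⟨fun ⟨hg, h⟩ ↦ ⟨hg, h12.symm.trans h⟩, fun ⟨hg, h⟩ ↦ ⟨hg, h12.trans h⟩⟩

/-! ## Limits along `ℝ` -/

/-- `⌊u⌋₊^{s}/u^{s} → 1` and `(⌊u⌋₊ + 1)^{s}/u^{s} → 1` as `u → ∞` (any real exponent `s`). [folklore] -/
theorem tendsto_nat_floor_rpow_div_rpow (s : ℝ) :
    Tendsto (fun u : ℝ ↦ (⌊u⌋₊ : ℝ) ^ s / u ^ s) atTop (𝓝 1) ∧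
      Tendsto (fun u : ℝ ↦ ((⌊u⌋₊ : ℝ) + 1) ^ s / u ^ s) atTop (𝓝 1) := by
  have h1 : Tendsto (fun u : ℝ ↦ ((⌊u⌋₊ : ℝ) / u) ^ s) atTop (𝓝 1) := by
    have := (tendsto_nat_floor_div_atTop (R := ℝ)).rpow_const (p := s) (Or.inl one_ne_zero)
    rwa [Real.one_rpow] at this
  have h2 : Tendsto (fun u : ℝ ↦ (((⌊u⌋₊ : ℝ) + 1) / u) ^ s) atTop (𝓝 1) := by
    have hsum : Tendsto (fun u : ℝ ↦ (⌊u⌋₊ : ℝ) / u + u⁻¹) atTop (𝓝 (1 + 0)) :=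
      (tendsto_nat_floor_div_atTop (R := ℝ)).add tendsto_inv_atTop_zero
    rw [add_zero] at hsum
    have := hsum.rpow_const (p := s) (Or.inl one_ne_zero)
    rw [Real.one_rpow] at this
    refine this.congr' ?_
    filter_upwards [eventually_gt_atTop 0] with u hu
    rw [add_div, ← one_div]
  refine ⟨h1.congr' ?_, h2.congr' ?_⟩
  · filter_upwards [eventually_gt_atTop 0] with u hu
    rw [Real.div_rpow (Nat.cast_nonneg _) hu.le]
  · filter_upwards [eventually_gt_atTop 0] with u hu
    rw [Real.div_rpow (by positivity) hu.le]

/-- **From `ℕ` to `ℝ` for the monotone count `L = N(S^F; ·)`**: if `L(c₁n)/n^{5/6} → ℓ` along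
`n ∈ ℕ` then `L(c₁u)/u^{5/6} → ℓ` along real `u → ∞` (sandwich between `n = ⌊u⌋` and `⌊u⌋ + 1`).
[folklore] -/
theorem tendsto_locSolIrredClassCount_div_rpow (h16 : bhargavaShankar_classCount) {c₁ ℓ : ℝ}
    (hc₁ : 0 < c₁)
    (h : Tendsto (fun n : ℕ ↦ (locSolIrredClassCount (c₁ * n) : ℝ) / (n : ℝ) ^ (5 / 6 : ℝ)) atTop (𝓝 ℓ)) :
    Tendsto (fun u : ℝ ↦ (locSolIrredClassCount (c₁ * u) : ℝ) / u ^ (5 / 6 : ℝ)) atTop (𝓝 ℓ) := by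
  set L : ℝ → ℝ := fun Y ↦ (locSolIrredClassCount Y : ℝ) with hL
  have hmono : ∀ {Y Y' : ℝ}, Y ≤ Y' → L Y ≤ L Y' := fun hY ↦ by
    simp only [hL]; exact_mod_cast locSolIrredClassCount_mono h16 hY
  obtain ⟨hfl, hfl1⟩ := tendsto_nat_floor_rpow_div_rpow (5 / 6)
  -- lower bound `L(c₁⌊u⌋)/u^{5/6} → ℓ`
  have hlow : Tendsto (fun u : ℝ ↦ L (c₁ * ⌊u⌋₊) / u ^ (5 / 6 : ℝ)) atTop (𝓝 ℓ) := by
    have h' := (h.comp (tendsto_nat_floor_atTop (α := ℝ))).mul hfl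
    rw [mul_one] at h'
    refine h'.congr' ?_
    filter_upwards [eventually_ge_atTop 1] with u hu
    have hfl0 : (0 : ℝ) < (⌊u⌋₊ : ℝ) := by exact_mod_cast Nat.floor_pos.mpr hu
    have h5 : (0 : ℝ) < (⌊u⌋₊ : ℝ) ^ (5 / 6 : ℝ) := Real.rpow_pos_of_pos hfl0 _
    simp only [Function.comp_apply, hL]
    field_simp
  -- upper bound `L(c₁(⌊u⌋ + 1))/u^{5/6} → ℓ`
  have hupp : Tendsto (fun u : ℝ ↦ L (c₁ * ((⌊u⌋₊ : ℝ) + 1)) / u ^ (5 / 6 : ℝ)) atTop (𝓝 ℓ) := by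
    have h' := (h.comp ((tendsto_add_atTop_nat 1).comp (tendsto_nat_floor_atTop (α := ℝ)))).mul hfl1
    rw [mul_one] at h'
    refine h'.congr' ?_
    filter_upwards [eventually_ge_atTop 1] with u hu
    have h5 : (0 : ℝ) < ((⌊u⌋₊ : ℝ) + 1) ^ (5 / 6 : ℝ) := Real.rpow_pos_of_pos (by positivity) _
    simp only [Function.comp_apply, hL]
    push_cast
    field_simp
  refine tendsto_of_tendsto_of_tendsto_of_le_of_le' hlow hupp ?_ ?_
  · filter_upwards [eventually_gt_atTop 0] with u hu
    have hY : c₁ * ⌊u⌋₊ ≤ c₁ * u := mul_le_mul_of_nonneg_left (Nat.floor_le hu.le) hc₁.le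
    exact div_le_div_of_nonneg_right (hmono hY) (Real.rpow_nonneg hu.le _)
  · filter_upwards [eventually_gt_atTop 0] with u hu
    have hY : c₁ * u ≤ c₁ * ((⌊u⌋₊ : ℝ) + 1) :=
      mul_le_mul_of_nonneg_left (Nat.lt_floor_add_one u).le hc₁.le
    exact div_le_div_of_nonneg_right (hmono hY) (Real.rpow_nonneg hu.le _)

/-- **Thm 2.1 along the reals**: `N(V_ℤ^{(0)} ∪ V_ℤ^{(2+)} ∪ V_ℤ^{(1)}; c₁u)/u^{5/6} → (8/27)ζ(2)c₁^{5/6}`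
(`abs_classCount_union_sub_le`: the error is `O((c₁u)^{19/24})`). [cite: BhargavaShankarAnnals2015, Thm 2.1 and §5.4 eq. (31), third line (arXiv:1006.1002v2 numbering)] -/
theorem tendsto_classCount_union_div_rpow (h16 : bhargavaShankar_classCount) {c₁ : ℝ} (hc₁ : 0 < c₁) :
    Tendsto (fun u : ℝ ↦ (gl2zClassCount (fourRealRoots ∪ posDefinite ∪ twoRealRoots) (c₁ * u) : ℝ) /
        u ^ (5 / 6 : ℝ)) atTop (𝓝 (8 / 27 * (Real.pi ^ 2 / 6) * c₁ ^ (5 / 6 : ℝ))) := by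
  set κ : ℝ := 8 / 27 * (Real.pi ^ 2 / 6) with hκ
  set N' : ℝ → ℝ := fun Y ↦ (gl2zClassCount (fourRealRoots ∪ posDefinite ∪ twoRealRoots) Y : ℝ)
    with hN'
  obtain ⟨C, hC⟩ := abs_classCount_union_sub_le h16
  -- the difference tends to `0`
  have hdiff : Tendsto (fun u : ℝ ↦ N' (c₁ * u) / u ^ (5 / 6 : ℝ) - κ * c₁ ^ (5 / 6 : ℝ)) atTop (𝓝 0) := by
    have hb : Tendsto (fun u : ℝ ↦ |C| * c₁ ^ (3 / 4 + 1 / 24 : ℝ) * u ^ (-(1 / 24 : ℝ))) atTop (𝓝 0) := by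
      have := (tendsto_rpow_neg_atTop (by norm_num : (0 : ℝ) < 1 / 24)).const_mul
        (|C| * c₁ ^ (3 / 4 + 1 / 24 : ℝ))
      rwa [mul_zero] at this
    refine squeeze_zero_norm' ?_ hb
    filter_upwards [eventually_ge_atTop (max 1 c₁⁻¹)] with u hu
    have hu1 : 1 ≤ u := le_of_max_le_left hu
    have hu0 : 0 < u := by linarith
    have hY : 1 ≤ c₁ * u := by
      have := mul_le_mul_of_nonneg_left (le_of_max_le_right hu) hc₁.le
      rwa [mul_inv_cancel₀ hc₁.ne'] at this
    have hu5 : 0 < u ^ (5 / 6 : ℝ) := Real.rpow_pos_of_pos hu0 _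
    rw [Real.norm_eq_abs]
    have hrew : N' (c₁ * u) / u ^ (5 / 6 : ℝ) - κ * c₁ ^ (5 / 6 : ℝ) =
        (N' (c₁ * u) - κ * (c₁ * u) ^ (5 / 6 : ℝ)) / u ^ (5 / 6 : ℝ) := by
      rw [Real.mul_rpow hc₁.le hu0.le]
      field_simp
    rw [hrew, abs_div, abs_of_pos hu5, div_le_iff₀ hu5]
    calc |N' (c₁ * u) - κ * (c₁ * u) ^ (5 / 6 : ℝ)| ≤ C * (c₁ * u) ^ (3 / 4 + 1 / 24 : ℝ) := hC _ hY
      _ ≤ |C| * (c₁ * u) ^ (3 / 4 + 1 / 24 : ℝ) :=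
          mul_le_mul_of_nonneg_right (le_abs_self C) (by positivity)
      _ = |C| * c₁ ^ (3 / 4 + 1 / 24 : ℝ) * u ^ (-(1 / 24 : ℝ)) * u ^ (5 / 6 : ℝ) := by
          rw [Real.mul_rpow hc₁.le hu0.le, mul_assoc (|C| * c₁ ^ (3 / 4 + 1 / 24 : ℝ)),
            ← Real.rpow_add hu0]
          norm_num
          ring
  have := hdiff.add_const (κ * c₁ ^ (5 / 6 : ℝ))
  rw [zero_add] at this
  exact this.congr fun u ↦ by ring

/-- **The constant of display (31)**: `(8/27)ζ(2)·(2¹⁰·27)^{5/6}·∏_p |2¹⁰/27|_p M_p(V,F) = 2·c_F`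
(`eq31_constant`, `hasProd_localFactor`, Lemma 5.16 = `brumerKramer_card_quotient_two_holds`).
[cite: BhargavaShankarAnnals2015, §5.4 eq. (31), lines 3–4, and the last display of §5.4 (arXiv:1006.1002v2 numbering)] -/
theorem eq31_sieve_constant :
    8 / 27 * (Real.pi ^ 2 / 6) * ((2 : ℝ) ^ 10 * 27) ^ (5 / 6 : ℝ) *
        ∏' p : Nat.Primes, ((padicNorm p ((2 : ℚ) ^ 10 / 3 ^ 3) : ℚ) : ℝ) * @localMassV p ⟨p.2⟩ =
      2 * heightFamilyConstant := by
  rw [(hasProd_localFactor brumerKramer_card_quotient_two_holds).tprod_eq, heightFamilyConstant]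
  have := eq31_constant
  calc 8 / 27 * (Real.pi ^ 2 / 6) * ((2 : ℝ) ^ 10 * 27) ^ (5 / 6 : ℝ) *
        (((2 : ℝ) ^ 9)⁻¹ * (3 : ℝ)⁻¹ * (6 / Real.pi ^ 2) *
          ∏' p : Nat.Primes, (1 - 1 / ((p : ℕ) : ℝ) ^ 10))
      = (8 / 27 * (Real.pi ^ 2 / 6) * ((2 : ℝ) ^ 10 * 27) ^ (5 / 6 : ℝ) *
          (((2 : ℝ) ^ 9)⁻¹ * (3 : ℝ)⁻¹ * (6 / Real.pi ^ 2))) *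
          ∏' p : Nat.Primes, (1 - 1 / ((p : ℕ) : ℝ) ^ 10) := by ring
    _ = 2 * (4 / ((4 : ℝ) ^ (1 / 3 : ℝ) * (27 : ℝ) ^ (1 / 2 : ℝ))) *
          ∏' p : Nat.Primes, (1 - 1 / ((p : ℕ) : ℝ) ^ 10) := by rw [this]
    _ = 2 * (4 / ((4 : ℝ) ^ (1 / 3 : ℝ) * (27 : ℝ) ^ (1 / 2 : ℝ)) *
          ∏' p : Nat.Primes, (1 - 1 / ((p : ℕ) : ℝ) ^ 10)) := by ring

/-! ## The converse reduction and the equivalence -/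

/-- **eq. (31) ∧ Thm 2.1 ⇒ the sieve step (†)** (converse of
`bhargavaShankar_sum_irredClassCount_asymptotic_of_two_facts`): with `c₁ = 2¹⁰·27`,
`L(c₁u)/u^{5/6} → 2c_F` (eq. (31), `sum_pgl2QClassCount_eq_locSolIrredClassCount`, monotone
interpolation) and `N'(c₁u)/u^{5/6} → κc₁^{5/6}` (Thm 2.1) give `(L − N'·P)(c₁u)/u^{5/6} →
2c_F − κc₁^{5/6}P = 0` (`eq31_sieve_constant`); put `u = 4X/27`, `c₁u = 2¹²X`.
[cite: BhargavaShankarAnnals2015, §5.4 eq. (31) (arXiv:1006.1002v2 numbering)] -/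
theorem bhargavaShankar_locSolIrredClassCount_asymptotic_of_sum_irredClassCount_asymptotic
    (h31 : bhargavaShankar_sum_irredClassCount_asymptotic) (h16 : bhargavaShankar_classCount) :
    bhargavaShankar_locSolIrredClassCount_asymptotic := by
  -- notation
  set c₁ : ℝ := (2 : ℝ) ^ 10 * 27 with hc₁
  have hc₁pos : 0 < c₁ := by rw [hc₁]; norm_num
  set κ : ℝ := 8 / 27 * (Real.pi ^ 2 / 6) with hκ
  set P : ℝ := ∏' p : Nat.Primes, ((padicNorm p ((2 : ℚ) ^ 10 / 3 ^ 3) : ℚ) : ℝ) *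
    @localMassV p ⟨p.2⟩ with hP
  set N' : ℝ → ℝ := fun Y ↦ (gl2zClassCount (fourRealRoots ∪ posDefinite ∪ twoRealRoots) Y : ℝ)
    with hN'
  set L : ℝ → ℝ := fun Y ↦ (locSolIrredClassCount Y : ℝ) with hL
  have hconst : κ * c₁ ^ (5 / 6 : ℝ) * P = 2 * heightFamilyConstant := eq31_sieve_constant
  -- (1) eq. (31) as a statement about `L(c₁ n)`, `n ∈ ℕ`
  have hLnat : Tendsto (fun n : ℕ ↦ L (c₁ * n) / (n : ℝ) ^ (5 / 6 : ℝ)) atTop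
      (𝓝 (2 * heightFamilyConstant)) := by
    have h := h31
    unfold bhargavaShankar_sum_irredClassCount_asymptotic at h
    refine h.congr fun n ↦ ?_
    simp only [hL, hc₁]
    rw [← sum_pgl2QClassCount_eq_locSolIrredClassCount h16 n, Nat.cast_sum]
  -- (2) along the reals
  have hLreal : Tendsto (fun u : ℝ ↦ L (c₁ * u) / u ^ (5 / 6 : ℝ)) atTop
      (𝓝 (2 * heightFamilyConstant)) :=
    tendsto_locSolIrredClassCount_div_rpow h16 hc₁pos hLnat
  have hN'real : Tendsto (fun u : ℝ ↦ N' (c₁ * u) / u ^ (5 / 6 : ℝ)) atTop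
      (𝓝 (κ * c₁ ^ (5 / 6 : ℝ))) :=
    tendsto_classCount_union_div_rpow h16 hc₁pos
  -- (3) the difference along `u`
  have hD : Tendsto (fun u : ℝ ↦ (L (c₁ * u) - N' (c₁ * u) * P) / u ^ (5 / 6 : ℝ)) atTop (𝓝 0) := by
    have h := hLreal.sub (hN'real.mul_const P)
    rw [hconst, sub_self] at h
    refine h.congr fun u ↦ ?_
    ring
  -- (4) substitute `u = 4X/27`
  have hu : Tendsto (fun X : ℝ ↦ (4 / 27 : ℝ) * X) atTop atTop :=
    Tendsto.const_mul_atTop (by norm_num) tendsto_id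
  have h := (hD.comp hu).mul_const ((4 / 27 : ℝ) ^ (5 / 6 : ℝ))
  rw [zero_mul] at h
  show Tendsto (fun X : ℝ ↦ (L (2 ^ 12 * X) - N' (2 ^ 12 * X) * P) / X ^ (5 / 6 : ℝ)) atTop (𝓝 0)
  refine h.congr' ?_
  filter_upwards [eventually_gt_atTop 0] with X hX
  simp only [Function.comp_apply]
  have h274 : (0 : ℝ) < (4 / 27 : ℝ) ^ (5 / 6 : ℝ) := Real.rpow_pos_of_pos (by norm_num) _
  have hX5 : (0 : ℝ) < X ^ (5 / 6 : ℝ) := Real.rpow_pos_of_pos hX _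
  rw [show c₁ * (4 / 27 * X) = 2 ^ 12 * X by rw [hc₁]; ring,
    Real.mul_rpow (by norm_num) hX.le]
  field_simp

/-- **The sieve step (†) and eq. (31) are equivalent granted Thm 2.1**
(`bhargavaShankar_sum_irredClassCount_asymptotic_of_two_facts` and its converse above): the two
named facts cut from display (31) differ exactly by the separately vendored Thm 2.1
(`bhargavaShankar_classCount`) — a discharge of either discharges the other once Thm 2.1 is a
theorem. [cite: BhargavaShankarAnnals2015, §5.4 eq. (31) (arXiv:1006.1002v2 numbering)] -/
theorem bhargavaShankar_locSolIrredClassCount_asymptotic_iff (h16 : bhargavaShankar_classCount) :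
    bhargavaShankar_locSolIrredClassCount_asymptotic ↔ bhargavaShankar_sum_irredClassCount_asymptotic :=
  ⟨fun h ↦ bhargavaShankar_sum_irredClassCount_asymptotic_of_two_facts h h16,
    fun h ↦ bhargavaShankar_locSolIrredClassCount_asymptotic_of_sum_irredClassCount_asymptotic h h16⟩

end Literature.NumberTheory.EllipticCurves

end
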